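import Summits.PneNP.PneNP.Theorems.SoloInformedStreamingRung
import Summits.PneNP.PneNP.Theorems.SoloInformedStreamingCeiling

/-! # SoloInformedStreamingFloor — the state-counting window of the MMW19 door, time-free

Solo informed, generation 5.  The floor rungs of `SoloInformedStreamingRung.lean` are proved by
counting states only; here they are restated in that honest form — for an ARBITRARY one-pass
streaming algorithm `A` (no machine, no update or report time): if `A` runs in space `S` with
`S(2ⁿ)` below `log₂ N · log₂ log₂ N − O(log₂ N)` at one length, then `A` does not decide `MCSP[n]`.
Together with the ceiling `SoloInformedStreamingCeiling.lean` this gives the kernel-checked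
STATE-COUNTING WINDOW of the McKay–Murray–Williams door for `MCSP[n]`:

* space `(log₂ N)^c + c`, `c ≤ 1`: no streaming algorithm at all (`soloInformed_floor_rung`);
* space `(log₂ N)^3 + 3`: some streaming algorithm, with an arbitrary update map
  (`soloInformed_mcspSize_id_decides_in_space_cube`);

so the conjuncts `c ≥ 3` of `StreamingLowerBound (fun n => n)` — any one of whose tails gives
`PneNP` (`soloInformed_pneNP_of_streamingLowerBound_id_two_le`) — are statements about uniform
update/report TIME, invisible to state counting (`soloInformed_stateCounting_window`).
-/

noncomputable section
namespace Summit.PneNP.PneNP.Theorems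
open Finset Literature.Computability.Complexity Literature.Computability.MetaComplexity
open Literature.Computability.MetaComplexity.McKayMurrayWilliams2019
open scoped Nat

/-- **Time-free floor, raw form.** Any one-pass streaming algorithm running in space `S` with
`(S(2ⁿ)+1)·2^{S(2ⁿ)}·2n(16(2n+1)²)ⁿ < (n−2)!²·n!` at some `n ≥ 3` fails to decide `MCSP[n]`
(fooling family of read-once caterpillars + sharp circuit count; no use of update time). -/
theorem soloInformed_mcspSize_id_not_decides_of_lt (A : StreamingAlgorithm) (S : ℕ → ℕ)
    (hS : RunsInSpace A S) (n : ℕ) (hn : 3 ≤ n)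
    (h : (S (2 ^ n) + 1) * 2 ^ S (2 ^ n) * ((n + n) * (16 * (n + n + 1) ^ 2) ^ n) <
      (n - 2)! ^ 2 * n !) :
    ¬ A.Decides (MCSPSize fun n => n) := by
  classical
  obtain ⟨k, rfl⟩ : ∃ k, n = k + 3 := ⟨n - 3, by omega⟩
  intro hD
  have hk2 : k + 3 - 2 = k + 1 := by omega
  rw [hk2] at h
  refine not_decides_of_fooling A hS (ι := Equiv.Perm (Fin (k + 1))) (N := 2 ^ (k + 3))
    (fun π => truthTable (gFun k π)) (fun π => truthTable (gFun k π)) (length_word k)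
    (diag_mem k) (B := (univ.filter fun F : (Fin (k + 3) → Bool) → Bool =>
      circuitSizeOver B2 F ≤ k + 3).card) (card_good_le k) ?_ hD
  have hC := CircuitCount.card_circuitSizeOver_le_mul_factorial_le (k + 3) (k + 3)
  have hcard : Fintype.card (Equiv.Perm (Fin (k + 1))) = (k + 1)! := by
    rw [Fintype.card_perm, Fintype.card_fin]
  rw [hcard]
  by_contra hge
  rw [not_lt] at hge
  have := calc (k + 1)! ^ 2 * (k + 3)!
      ≤ (S (2 ^ (k + 3)) + 1) * 2 ^ S (2 ^ (k + 3)) *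
          (univ.filter fun F : (Fin (k + 3) → Bool) → Bool =>
            circuitSizeOver B2 F ≤ k + 3).card * (k + 3)! := Nat.mul_le_mul_right _ hge
    _ = (S (2 ^ (k + 3)) + 1) * 2 ^ S (2 ^ (k + 3)) *
          ((univ.filter fun F : (Fin (k + 3) → Bool) → Bool =>
            circuitSizeOver B2 F ≤ k + 3).card * (k + 3)!) := by ring
    _ ≤ (S (2 ^ (k + 3)) + 1) * 2 ^ S (2 ^ (k + 3)) *
          ((k + 3 + (k + 3)) * (16 * (k + 3 + (k + 3) + 1) ^ 2) ^ (k + 3)) :=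
          Nat.mul_le_mul_left _ hC
  exact absurd h (not_lt.2 this)

/-- **Time-free floor.** A one-pass streaming algorithm whose space is `≤ n + 1 = log₂ N + 1` at a
single length `N = 2ⁿ`, `n ≥ 2¹⁵ + 2`, does not decide `MCSP[n]`. -/
theorem soloInformed_mcspSize_id_not_decides (A : StreamingAlgorithm) (S : ℕ → ℕ)
    (hS : RunsInSpace A S) (h : ∃ n, 2 ^ 15 + 2 ≤ n ∧ S (2 ^ n) ≤ n + 1) :
    ¬ A.Decides (MCSPSize fun n => n) := by
  obtain ⟨n, hn, hSn⟩ := h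
  obtain ⟨t, rfl⟩ : ∃ t, n = t + 2 := ⟨n - 2, by omega⟩
  refine soloInformed_mcspSize_id_not_decides_of_lt A S hS (t + 2) (by omega) ?_
  have := numeric_bound t (by omega) (S (2 ^ (t + 2))) (by omega)
  simpa using this

/-- **Floor rungs `c ≤ 1`, time-free**: no one-pass streaming algorithm with `(log₂ N)^c + c` bits
of state decides `MCSP[n]`, for `c ≤ 1`. -/
theorem soloInformed_floor_rung (c : ℕ) (hc : c ≤ 1) (A : StreamingAlgorithm)
    (hS : RunsInSpace A fun N => Nat.log 2 N ^ c + c) : ¬ A.Decides (MCSPSize fun n => n) := by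
  refine soloInformed_mcspSize_id_not_decides A _ hS ⟨2 ^ 15 + 2, le_rfl, ?_⟩
  show Nat.log 2 (2 ^ (2 ^ 15 + 2)) ^ c + c ≤ 2 ^ 15 + 2 + 1
  rw [Nat.log_pow (by norm_num)]
  interval_cases c <;> simp

/-- **The state-counting window of the McKay–Murray–Williams door for `MCSP[n]`.**  With state
`(log₂ N)^c + c`, `c ≤ 1`, NO one-pass streaming algorithm (any update map) decides `MCSP[n]`;
with state `(log₂ N)^3 + 3` SOME one-pass streaming algorithm (some update map, empty initial
state) does.  Hence the conjuncts `c ≥ 3` of `StreamingLowerBound (fun n => n)`, whose tail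
implies `PneNP`, cannot be settled by any argument that only bounds the number of states: they are
claims about the uniform update/report time of `USTREAM`. -/
theorem soloInformed_stateCounting_window :
    (∀ c ≤ 1, ¬ ∃ A : StreamingAlgorithm,
        RunsInSpace A (fun N => Nat.log 2 N ^ c + c) ∧ A.Decides (MCSPSize fun n => n)) ∧
    (∃ A : StreamingAlgorithm, (∀ N, A.init N = []) ∧
        RunsInSpace A (fun N => Nat.log 2 N ^ 3 + 3) ∧ A.Decides (MCSPSize fun n => n)) :=
  ⟨fun c hc ⟨A, hS, hD⟩ => soloInformed_floor_rung c hc A hS hD,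
    soloInformed_mcspSize_id_decides_in_space_cube⟩

end Summit.PneNP.PneNP.Theorems
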